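import Summits.BirchSwinnertonDyer.BirchSwinnertonDyer.Theorems.SchneiderFreeAdditiveX3ControlLeMinimal
import Summits.BirchSwinnertonDyer.BirchSwinnertonDyer.Theorems.SchneiderFreeAdditiveX3BranchBDPValueOfLZZ
import Summits.BirchSwinnertonDyer.Rank1Residual.X11b.BDPRouteHsiehFrameSupplied
import Summits.BirchSwinnertonDyer.Rank1Residual.X11b.EmbeddingDatumPrime
import Summits.BirchSwinnertonDyer.Rank1Residual.X11b.CharIdealTrivialCharacter
import Literature.NumberTheory.EllipticCurves.Hsieh2014.AnticyclotomicPAdicLFunctionAnyLevel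
import Literature.FieldTheory.AlgClosed.PadicAlgClEquivComplex
import HarnessLib

/-!
# Route `SchneiderFreeAdditiveX3` (K1 door): its two branch cruxes `PotMultBranchIMC` (19176) and `GordTwoBranchIMC`
# (19177) from Poitou–Tate duality, Kolyvagin, TWO REFEREED INPUTS (Hsieh 2014 Thm A any level; Liu–Zhang–Zhang 2018
# Thm 1.5.1/1.5.3 additive) and ONE typed analytic half — the ♭-DIVISIBILITY `Ch_Λ(X_ac^∅)·𝓞_{ℂ_p}⟦T⟧ ⊆ (Q)` — in place
# of the three typed halves H1 (an `R₀`-frame exists) / H2 (its value) / H3 (the `R₀`-divisibility)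

Prover seat `bsd-potss-kmc` (g19), cell `bsd-potss`, 2026-08-27; offered to route `SchneiderFreeAdditiveX3` (cell
`bsd-schneider`). HONEST FRAMING: THEOREMS ONLY (0 definitions, 0 named facts, 0 `sorry`); nothing is closed; every
statement is CONDITIONAL on its displayed hypotheses; BSD_p is proved for no curve. WHY: the door's complete residual
`additiveX3RankOneLower_of_printedFacts_of_pt_of_typedHalves` consumes, on each of the two cells, H1
`BranchBDPExistsAt` (an `R₀`-VALUED frame of `Dt.f` exists — not in print at `p² ∣ N`), H2 `BranchBDPValueLeAt` (a
THEOREM modulo LZZ, companion file `…BranchBDPValueOfLZZ`) and H3 `BranchIMCDivAt` (the `R₀`-divisibility). Over the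
WIDE receptacle `𝓞_{ℂ_p}⟦T⟧` the frame EXISTS by Hsieh 2014 Thm A at any level (tree fact
`Hsieh2014.thmA_exists_isHsiehLFunction_unrPeriod_anyLevel`, supply `X11b.lambdaSupplyAt`, glue
`X11b.exists_isBDPLFunctionInt_of_isHsiehLFunction`) and its value is the companion file's `intSeries_value_of_frame_tors`;
the socket `SchneiderFree.AdditiveIMCLowerBDPOnTreeLeAt` is frame-free and reads only `ord_p` of a constant term, for
which `‖u‖ = 1` over `𝓞_{ℂ_p}` is as good as `u ∈ R₀ˣ` (X11b `RouteR1IntReceptacle`: «`R₀` was never load-bearing»).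
Hence the socket — and with it each branch crux — needs from the analytic side ONLY the ♭-divisibility

  H3♭(W, p):  over H3's binders, for every `ι′` inducing `𝔭` and EVERY ♭-frame `(Ω_K ≠ 0, Ω_p ≠ 0, Q ∈ 𝓞_{ℂ_p}⟦T⟧)`
  with `X11b.R1.IsBDPLFunctionInt p ι′ 𝔭 κ γ Dt.f Ω_K Ω_p Q`:
  `(XAc.charIdeal (W.baseChange K) p κ 𝔭 ∅ γ).map (PowerSeries.map (X11b.R1.toCpInt p)) ≤ Ideal.span {Q}`

(stated INLINE as a hypothesis below — a `def` is the route planner's to add to `SchneiderFreeAdditiveX3Defs.lean`; by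
♭ cross-period rigidity `X11b.R1.span_singleton_eq_of_isBDPLFunctionInt` the ∀-frame and ∃-frame forms are equivalent,
and H3♭ ⟸ H3 ∧ H1 by `Ideal.map_mono` along `R₀ ⊆ 𝓞_{ℂ_p}`).

* §1 **`additiveIMCLowerBDPInputManinAt_of_pt_of_kolyvagin_of_hsieh_of_lzz_of_intDiv`** — the socket
  `AdditiveIMCLowerBDPInputManinAt W p` on a pair of the door (`r_an = 1`, odd `p`, `ClassX3`, `SubSemistableTwist`) from
  `hPT`, `hKo`, `hA` (Hsieh), `hL` (LZZ) and H3♭(W, p): CTL₀ (`exists_hasCharValuationAt_of_pt_of_kolyvagin`), the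
  ♭-frame, its value `u·(log_ω P/c)²` with `‖u‖ = 1`, the divisibility, and the lower norm half over `𝓞_{ℂ_p}⟦T⟧`
  (`‖f(0)‖ ≤ ‖Q(0)‖ = ‖log_ω P/c‖²`, inlined) ⟹ `2·ord_p log_ω P ≤ n + 2·v_p(c)`.
* §2 **`potMultBranchIMC_of_pt_of_kolyvagin_of_hsieh_of_lzz_of_intDiv`**, **`gordTwoBranchIMC_of_…`** — the two route
  cruxes BY NAME from the same inputs with H3♭ quantified over the cell.

References: [JetchevSkinnerWan2017] §7.4.1 (the assembly); [Castella2018] §5 (5.1)–(5.3); [Hsieh2014] Thm A;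
[LiuZhangZhang2018] Thm 1.5.1/1.5.3; [MilneADT2006] I.4.10; [Kolyvagin1990].
-/

set_option autoImplicit false

-- D-0017 layout: summit = sub-problem, so `Summit.BirchSwinnertonDyer.BirchSwinnertonDyer.…` is the
-- mandated namespace of Theorems files (same option as the route's sibling Theorems files).
set_option linter.dupNamespace false

noncomputable section

open scoped Classical NumberField

namespace Summit.BirchSwinnertonDyer.BirchSwinnertonDyer.Theorems.SchneiderFreeAdditiveX3

open Field NumberField IsDedekindDomain WeierstrassCurve PowerSeries
  Literature.NumberTheory.EllipticCurves Literature.NumberTheory.EllipticCurves.GreenbergSelmer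
  Literature.NumberTheory.GaloisRepresentations Literature.NumberTheory.GaloisCohomology
  Literature.NumberTheory.EllipticCurves.ModularForms Literature.NumberTheory.EllipticCurves.Rank1Residual
  Summit.BirchSwinnertonDyer.Rank1Residual Summit.BirchSwinnertonDyer.Rank1Residual.X11b
  Summit.BirchSwinnertonDyer.Rank1Residual.X11b.AcSelmer Summit.BirchSwinnertonDyer.Rank1Residual.X11b.Halves
  Summit.BirchSwinnertonDyer.Rank1Residual.X11b.CongruenceLimit
  Summit.BirchSwinnertonDyer.BirchSwinnertonDyer.Theorems.SchneiderFree
  Summit.BirchSwinnertonDyer.BirchSwinnertonDyer.Theses.SchneiderFreeAdditiveX3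

/-! ### §1 The socket from two refereed inputs and the ♭-divisibility -/

/-- **The additive socket `AdditiveIMCLowerBDPInputManinAt W p` from Poitou–Tate duality, Kolyvagin, Hsieh (any level),
LZZ (additive) and the ♭-DIVISIBILITY only.** On a pair of the door (`r_an = 1`, `p ≠ 2`, `ClassX3 W p`,
`SubSemistableTwist W p`): for every Heegner/parametrisation datum of the socket and every frame `(κ, γ, 𝔭)` — CTL₀ gives
`n` with `Ch_Λ(X_ac^∅) = (f)`, `ord_p f(0) = n`; an embedding datum `ι′` induces `𝔭`; Hsieh gives a ♭-frame `Q` of `Dt.f` at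
`(ι′, 𝔭)`; LZZ pins `Q(0) = u·(log_ω P / c)²` with `‖u‖ = 1` (`intSeries_value_of_frame_tors`); the displayed ♭-divisibility
`hDiv` puts `f` in `(Q)` over `𝓞_{ℂ_p}⟦T⟧`; norms give `‖f(0)‖ ≤ ‖Q(0)‖ = ‖log_ω P/c‖²`, i.e.
`2·ord_p log_ω P ≤ n + 2·v_p(c)`. CONDITIONAL on `hPT`, `hKo`, `hA`, `hL`, `hDiv`; replaces the triple (H1, H2, H3) of
`additiveIMCLowerBDPInputManinAt_of_pt_of_kolyvagin_of_halves` by (Hsieh, LZZ, H3♭).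
[cite: JetchevSkinnerWan2017, §7.4.1 (arXiv:1512.06894 p. 30)] [cite: Hsieh2014, Thm. A p. 712 (Doc. Math. 19)]
[cite: LiuZhangZhang2018, Thm 1.5.1 and Thm 1.5.3 (Duke Math. J. 167 pp. 748–749)] -/
theorem additiveIMCLowerBDPInputManinAt_of_pt_of_kolyvagin_of_hsieh_of_lzz_of_intDiv
    (hPT : ∀ (K : Type) [Field K] [NumberField K], poitouTate_selmerStructure_duality K)
    (hKo : ∀ (N : ℕ) [NeZero N] (W : WeierstrassCurve ℚ) (K : Type) [Field K] [NumberField K],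
      Literature.NumberTheory.EllipticCurves.kolyvagin N W K)
    (hA : Hsieh2014.thmA_exists_isHsiehLFunction_unrPeriod_anyLevel)
    (hL : LiuZhangZhang2018.thm151_thm153_modularCurve_heegnerVector_additive)
    {W : WeierstrassCurve ℚ} [W.IsElliptic] [W.IsGloballyMinimal] {p : ℕ} [Fact p.Prime]
    (hr : W.analyticRank = 1) (hp2 : p ≠ 2) (hX : ClassX3 W p) (hS : Additive.SubSemistableTwist W p)
    (hDiv : ∀ (N : ℕ) [NeZero N] (K : Type) [Field K] [NumberField K]
      (Dt : ModularParametrizationData W N) (H : HeegnerDatum N (NumberField.discr K)) (ι : K →+* ℂ)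
      (P : (W.baseChange K).toAffine.Point),
      W.analyticRank = 1 → Additive.N10.Locus W p → W.conductorNorm ℤ = N → IsImaginaryQuadratic K →
      Odd (NumberField.discr K) → ¬ p ∣ Units.torsionOrder K → SatisfiesHeegnerHypothesis N K →
      (W.quadraticTwist (NumberField.discr K : ℚ)).entireLFunction 1 ≠ 0 →
      WeierstrassCurve.Affine.Point.map ι.toRatAlgHom P = heegnerPointComplex Dt H →
      ¬ IsOfFinAddOrder P →
      ∀ (κ : ZpExtension K p), κ.IsAnticyclotomic →
        ∀ (γ : Field.absoluteGaloisGroup K) [Fact (κ.IsTopGenerator γ)]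
          (𝔭 : HeightOneSpectrum (𝓞 K)), ((p : ℕ) : 𝓞 K) ∈ 𝔭.asIdeal →
          𝔭.asIdeal.ramificationIdx (𝓞 ℚ) = 1 → 𝔭.asIdeal.inertiaDeg (𝓞 ℚ) = 1 →
          ∀ (ι' : PadicAlgCl p ≃+* ℂ), BranchInducesPrime p ι' 𝔭 →
            ∀ (ΩK : ℂ) (Ωp : ℂ_[p]) (Q : PowerSeries (PadicComplexInt p)), ΩK ≠ 0 → Ωp ≠ 0 →
              R1.IsBDPLFunctionInt p ι' 𝔭 κ γ Dt.f ΩK Ωp Q →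
                (XAc.charIdeal (W.baseChange K) p κ 𝔭 ∅ γ).map (PowerSeries.map (R1.toCpInt p)) ≤
                  Ideal.span {Q}) :
    AdditiveIMCLowerBDPInputManinAt W p := by
  intro N _ K _ _ Dt H ι P hr' hloc hN hK hodd hunit hHe hL1 hP hnt κ hκ γ _ 𝔭 h𝔭 he hf
  have hp : p.Prime := Fact.out
  have hγ : κ.IsTopGenerator γ := Fact.out
  -- CTL₀: the characteristic ideal is principal with `ord_p f(0) = n`
  obtain ⟨n, hn⟩ := exists_hasCharValuationAt_of_pt_of_kolyvagin hPT hKo W p hr hp2 hX hS N K Dt H ι P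
    hr' hloc hN hK hodd hunit hHe hL1 hP hnt κ hκ γ 𝔭 h𝔭 he hf
  -- `p² ∣ N`
  have haddv : Addv W p := hloc.2.1
  have hp2N : p ^ 2 ∣ N := by
    by_contra h
    rw [← hN] at h
    rcases hasGoodReductionAtPrime_or_hasMultiplicativeReductionAtPrime_of_not_sq_dvd_conductorNorm (V := W) h
      with hg | hm
    · exact haddv.1 hg
    · exact haddv.2 hm
  have hpN : p ∣ N := dvd_trans (dvd_pow_self p two_ne_zero) hp2N
  have hsplit : ((Ideal.span {(p : ℤ)}).primesOver (𝓞 K)).ncard = 2 := hHe p hp hpN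
  -- an embedding datum inducing `𝔭` and the ♭-frame of `Dt.f` there (Hsieh, any level)
  obtain ⟨ι₀⟩ := PadicAlgCl.nonempty_ringEquiv_complex p
  obtain ⟨ι', -, hι'⟩ := exists_datum_forall_mem_iff p ι₀ hK h𝔭
  obtain ⟨lam, rlam, hlu, hinfl, hAQ, hunrl, havl, hfacl⟩ := lambdaSupplyAt hp2 ι' K κ hK hκ
  subst hN
  obtain ⟨A, ΩK₀, C, Ωp, Q₀, hA0, hΩK₀, hC, hQ₀⟩ :=
    hA ι' K 𝔭 κ γ Dt.f lam rlam hp2 Dt.isNewformOf.1 hK hsplit h𝔭 hι' hHe hlu hinfl hAQ hunrl havl hfacl hκ hγ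
  obtain ⟨ΩK, c, hΩK, -, hQ⟩ :=
    exists_isBDPLFunctionInt_of_isHsiehLFunction ι' 𝔭 κ γ Dt.f hpN hA0 hΩK₀ hC ((Ωp : unrIntegers p) : ℂ_[p]) hQ₀
  have hΩp : ((Ωp : unrIntegers p) : ℂ_[p]) ≠ 0 := fun h0 ↦ by
    have h1 := norm_coe_units_unrIntegers p Ωp
    rw [h0, norm_zero] at h1
    exact zero_ne_one h1
  set Q : PowerSeries (PadicComplexInt p) := PowerSeries.C c * Q₀ with hQdef
  -- the value of the frame at `𝟙` (LZZ, `‖u‖ = 1`)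
  obtain ⟨u, hu, hval⟩ :=
    UniversalToricDescentWaldspurgerFlat.intSeries_value_of_frame_tors hL W K 𝔭 κ γ Dt H ι P Dt.f Dt.isNewformOf
      hp2 rfl hp2N hK hunit h𝔭 he hf hHe hκ hP hnt ι' hι' hΩK hΩp hQ
  -- the ♭-divisibility at this frame
  have hdiv := hDiv (W.conductorNorm ℤ) K Dt H ι P hr' hloc rfl hK hodd hunit hHe hL1 hP hnt κ hκ γ 𝔭 h𝔭 he hf
    ι' hι' ΩK _ Q hΩK hΩp hQ
  -- the lower norm half over `𝓞_{ℂ_p}⟦T⟧`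
  obtain ⟨htors, f, hfI, hf0, hfn⟩ := hn
  have hmem : PowerSeries.map (R1.toCpInt p) f ∈ Ideal.span {Q} := by
    have h3 := hdiv
    rw [hfI, map_span_singleton_powerSeries] at h3
    exact (Ideal.span_singleton_le_iff_mem _).mp h3
  set x : ℚ_[p] := logOmega W p (embAt K p 𝔭 h𝔭 he hf) P / (Dt.c : ℚ_[p]) with hx
  have hQ0 : u * (algebraMap ℚ_[p] ℂ_[p] x) ^ 2 = ((constantCoeff Q : PadicComplexInt p) : ℂ_[p]) :=
    R1.intSeries_eq_constantCoeff_of_hasValueAt_zero p hval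
  obtain ⟨G, hG⟩ := Ideal.mem_span_singleton'.mp hmem
  have hfac : algebraMap ℚ_[p] ℂ_[p] ((constantCoeff f : ℤ_[p]) : ℚ_[p]) =
      ((constantCoeff G : PadicComplexInt p) : ℂ_[p]) * ((constantCoeff Q : PadicComplexInt p) : ℂ_[p]) := by
    rw [← R1.coe_toCpInt, ← constantCoeff_map_apply (R1.toCpInt p) f, ← hG, map_mul, MulMemClass.coe_mul]
  have hp1 : (1 : ℝ) < p := by exact_mod_cast hp.one_lt
  have hnormf : ‖((constantCoeff f : ℤ_[p]) : ℚ_[p])‖ ≤ ‖x‖ ^ 2 := by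
    calc ‖((constantCoeff f : ℤ_[p]) : ℚ_[p])‖
        = ‖algebraMap ℚ_[p] ℂ_[p] ((constantCoeff f : ℤ_[p]) : ℚ_[p])‖ := (norm_algebraMap' ℂ_[p] _).symm
      _ = ‖((constantCoeff G : PadicComplexInt p) : ℂ_[p])‖ * ‖((constantCoeff Q : PadicComplexInt p) : ℂ_[p])‖ := by
          rw [hfac, norm_mul]
      _ ≤ 1 * ‖((constantCoeff Q : PadicComplexInt p) : ℂ_[p])‖ :=
          mul_le_mul_of_nonneg_right (R1.norm_coe_padicComplexInt_le_one p _) (norm_nonneg _)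
      _ = ‖u‖ * ‖algebraMap ℚ_[p] ℂ_[p] x‖ ^ 2 := by rw [one_mul, ← hQ0, norm_mul, norm_pow]
      _ = ‖x‖ ^ 2 := by rw [hu, one_mul, norm_algebraMap']
  -- `x ≠ 0`
  have hlog : logOmega W p (embAt K p 𝔭 h𝔭 he hf) P ≠ 0 := R1.logOmega_ne_zero W p _ hnt
  have hc0 : Dt.c ≠ 0 := Dt.maninConstant_ne_zero_holds
  have hc0' : (Dt.c : ℚ_[p]) ≠ 0 := by exact_mod_cast hc0
  have hx0 : x ≠ 0 := div_ne_zero hlog hc0'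
  -- norms to valuations: `2·ord_p x ≤ ord_p f(0) = n`
  rw [← PadicInt.norm_def, PadicInt.norm_eq_zpow_neg_valuation hf0, Padic.norm_eq_zpow_neg_valuation hx0] at hnormf
  have hrhs : ((p : ℝ) ^ (-x.valuation)) ^ 2 = (p : ℝ) ^ (-(2 * x.valuation)) := by
    rw [← zpow_natCast ((p : ℝ) ^ (-x.valuation)) 2, ← zpow_mul]
    congr 1
    push_cast
    ring
  rw [hrhs, zpow_le_zpow_iff_right₀ hp1] at hnormf
  have hle : 2 * x.valuation ≤ ((constantCoeff f).valuation : ℤ) := by omega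
  rw [hx, div_eq_mul_inv, Padic.valuation_mul hlog (inv_ne_zero hc0'), Padic.valuation_inv,
    Padic.valuation_intCast, valuation_logOmega hlog, hfn] at hle
  refine ⟨n, ⟨htors, f, hfI, hf0, hfn⟩, ?_⟩
  simp only [padicValInt] at hle
  linarith

/-! ### §2 The two branch cruxes by name -/

/-- **Crux r2 `PotMultBranchIMC` (item 19176) ⇐ Poitou–Tate duality ∧ Kolyvagin ∧ Hsieh (any level) ∧ LZZ (additive) ∧
H3♭ on the (M) cell.** The triple (H1, H2, H3) of `potMultBranchIMC_of_pt_of_kolyvagin_of_typedHalves` is replaced by two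
refereed inputs and the ♭-divisibility `Ch_Λ(X_ac^∅)·𝓞_{ℂ_p}⟦T⟧ ⊆ (Q)` for every ♭-frame (displayed hypothesis `hM3`,
quantified over the cell). CONDITIONAL; nothing closed; on (M) no divisibility is in print.
[cite: KellerYin2024b, §3.1 Case II (arXiv:2410.23241 pp. 13–15) (scope statement only)] -/
theorem potMultBranchIMC_of_pt_of_kolyvagin_of_hsieh_of_lzz_of_intDiv
    (hPT : ∀ (K : Type) [Field K] [NumberField K], poitouTate_selmerStructure_duality K)
    (hKo : ∀ (N : ℕ) [NeZero N] (W : WeierstrassCurve ℚ) (K : Type) [Field K] [NumberField K],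
      Literature.NumberTheory.EllipticCurves.kolyvagin N W K)
    (hA : Hsieh2014.thmA_exists_isHsiehLFunction_unrPeriod_anyLevel)
    (hL : LiuZhangZhang2018.thm151_thm153_modularCurve_heegnerVector_additive)
    (hM3 : ∀ (W : WeierstrassCurve ℚ) [W.IsElliptic] [W.IsGloballyMinimal] (p : ℕ) [Fact p.Prime],
      W.analyticRank = 1 → p ≠ 2 → ClassX3 W p → Additive.SubM W p →
      ∀ (N : ℕ) [NeZero N] (K : Type) [Field K] [NumberField K]
        (Dt : ModularParametrizationData W N) (H : HeegnerDatum N (NumberField.discr K)) (ι : K →+* ℂ)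
        (P : (W.baseChange K).toAffine.Point),
        W.analyticRank = 1 → Additive.N10.Locus W p → W.conductorNorm ℤ = N → IsImaginaryQuadratic K →
        Odd (NumberField.discr K) → ¬ p ∣ Units.torsionOrder K → SatisfiesHeegnerHypothesis N K →
        (W.quadraticTwist (NumberField.discr K : ℚ)).entireLFunction 1 ≠ 0 →
        WeierstrassCurve.Affine.Point.map ι.toRatAlgHom P = heegnerPointComplex Dt H →
        ¬ IsOfFinAddOrder P →
        ∀ (κ : ZpExtension K p), κ.IsAnticyclotomic →
          ∀ (γ : Field.absoluteGaloisGroup K) [Fact (κ.IsTopGenerator γ)]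
            (𝔭 : HeightOneSpectrum (𝓞 K)), ((p : ℕ) : 𝓞 K) ∈ 𝔭.asIdeal →
            𝔭.asIdeal.ramificationIdx (𝓞 ℚ) = 1 → 𝔭.asIdeal.inertiaDeg (𝓞 ℚ) = 1 →
            ∀ (ι' : PadicAlgCl p ≃+* ℂ), BranchInducesPrime p ι' 𝔭 →
              ∀ (ΩK : ℂ) (Ωp : ℂ_[p]) (Q : PowerSeries (PadicComplexInt p)), ΩK ≠ 0 → Ωp ≠ 0 →
                R1.IsBDPLFunctionInt p ι' 𝔭 κ γ Dt.f ΩK Ωp Q →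
                  (XAc.charIdeal (W.baseChange K) p κ 𝔭 ∅ γ).map (PowerSeries.map (R1.toCpInt p)) ≤
                    Ideal.span {Q}) :
    PotMultBranchIMC := by
  intro W _ _ p _ hr hp2 hX hS
  exact additiveIMCLowerBDPInputManinAt_of_pt_of_kolyvagin_of_hsieh_of_lzz_of_intDiv hPT hKo hA hL hr hp2 hX (Or.inl hS)
    (hM3 W p hr hp2 hX hS)

/-- **Crux r3 `GordTwoBranchIMC` (item 19177) ⇐ Poitou–Tate duality ∧ Kolyvagin ∧ Hsieh (any level) ∧ LZZ (additive) ∧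
H3♭ on the (G-ord, `e = 2`) cell** (displayed hypothesis `hG3`; its `R₀`-typed sibling H3 is Keller–Yin Thm 3.5.1,
PREPRINT). CONDITIONAL; nothing closed. [cite: KellerYin2024b, Thm. 3.5.1 (arXiv:2410.23241 p. 20) (shape of H3; preprint)] -/
theorem gordTwoBranchIMC_of_pt_of_kolyvagin_of_hsieh_of_lzz_of_intDiv
    (hPT : ∀ (K : Type) [Field K] [NumberField K], poitouTate_selmerStructure_duality K)
    (hKo : ∀ (N : ℕ) [NeZero N] (W : WeierstrassCurve ℚ) (K : Type) [Field K] [NumberField K],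
      Literature.NumberTheory.EllipticCurves.kolyvagin N W K)
    (hA : Hsieh2014.thmA_exists_isHsiehLFunction_unrPeriod_anyLevel)
    (hL : LiuZhangZhang2018.thm151_thm153_modularCurve_heegnerVector_additive)
    (hG3 : ∀ (W : WeierstrassCurve ℚ) [W.IsElliptic] [W.IsGloballyMinimal] (p : ℕ) [Fact p.Prime],
      W.analyticRank = 1 → p ≠ 2 → ClassX3 W p → Additive.SubGordTwo W p →
      ∀ (N : ℕ) [NeZero N] (K : Type) [Field K] [NumberField K]
        (Dt : ModularParametrizationData W N) (H : HeegnerDatum N (NumberField.discr K)) (ι : K →+* ℂ)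
        (P : (W.baseChange K).toAffine.Point),
        W.analyticRank = 1 → Additive.N10.Locus W p → W.conductorNorm ℤ = N → IsImaginaryQuadratic K →
        Odd (NumberField.discr K) → ¬ p ∣ Units.torsionOrder K → SatisfiesHeegnerHypothesis N K →
        (W.quadraticTwist (NumberField.discr K : ℚ)).entireLFunction 1 ≠ 0 →
        WeierstrassCurve.Affine.Point.map ι.toRatAlgHom P = heegnerPointComplex Dt H →
        ¬ IsOfFinAddOrder P →
        ∀ (κ : ZpExtension K p), κ.IsAnticyclotomic →
          ∀ (γ : Field.absoluteGaloisGroup K) [Fact (κ.IsTopGenerator γ)]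
            (𝔭 : HeightOneSpectrum (𝓞 K)), ((p : ℕ) : 𝓞 K) ∈ 𝔭.asIdeal →
            𝔭.asIdeal.ramificationIdx (𝓞 ℚ) = 1 → 𝔭.asIdeal.inertiaDeg (𝓞 ℚ) = 1 →
            ∀ (ι' : PadicAlgCl p ≃+* ℂ), BranchInducesPrime p ι' 𝔭 →
              ∀ (ΩK : ℂ) (Ωp : ℂ_[p]) (Q : PowerSeries (PadicComplexInt p)), ΩK ≠ 0 → Ωp ≠ 0 →
                R1.IsBDPLFunctionInt p ι' 𝔭 κ γ Dt.f ΩK Ωp Q →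
                  (XAc.charIdeal (W.baseChange K) p κ 𝔭 ∅ γ).map (PowerSeries.map (R1.toCpInt p)) ≤
                    Ideal.span {Q}) :
    GordTwoBranchIMC := by
  intro W _ _ p _ hr hp2 hX hS
  exact additiveIMCLowerBDPInputManinAt_of_pt_of_kolyvagin_of_hsieh_of_lzz_of_intDiv hPT hKo hA hL hr hp2 hX (Or.inr hS)
    (hG3 W p hr hp2 hX hS)

end Summit.BirchSwinnertonDyer.BirchSwinnertonDyer.Theorems.SchneiderFreeAdditiveX3

end
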